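import Literature.NumberTheory.LFunctions.Zhang2022.RepairCrossFormSection10H2Pieces

/-!
# K-S3 faithfulness, `H₂`-blocks (pieces, transposed): formula I of one `ϰ`-component ON THE `m`-SIDE against `J₂`

Trunk T-ANT (NumberTheory/LFunctions). Repair rung F-S1R (D-0077) for Y. Zhang, *Discrete mean estimates and
the Landau–Siegel zero*, arXiv:2211.02515v1 [Zhang2022LandauSiegel] — **an unrefereed manuscript under
adjudication; nothing here asserts any of its claims.** Second half of `RepairCrossFormSection10H2Pieces`: the
blocks `Θ₁(𝐚₁₂, 𝐚₁₄)`-type where the mollifier component `ϰ_{ν,k}` is the `m`-side (`ϰ′ + iπjϰ = −𝔣𝔣_{j,k}(ν−y)/ν`,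
Lemma 8.2) and the reflected tent `f₂` of `J₂ = [1−ν₁, 1−ν₂]` is the `n`-side (tail functional `π²N_jh` below `J₂`,
`−σ(−1+𝔶𝔶₁ʳⱼ)` / `−σ(1+𝔶𝔶₂ʳⱼ)` on its halves, `0` above; Lemma 10.2):

* `integral_dip_kappa_rtent_full` (`1−ν₂ ≤ ν`, the `ῑ₄`-lines of `d₆ⱼ`: region `dr < P^{lo₂}` after `y = lo₂ − z`,
  lower half after `y = mid₂ − z` (argument `e + h + z`, `𝔶𝔶₁ʳ(mid₂ − z)`), upper half after `y = hi₂ − z`);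
* `integral_dip_kappa_rtent_part` (`1−ν₁ < ν₃ ≤ 1−ν₂`, the `ῑ₃`-lines: `d₆ⱼ` line 1 with `L₆ + z`, `d′₆ⱼ` on
  `[g₀, L₆]`, the `𝔶𝔶₁ʳ`-part on the clipped window `[min(h, max(0, mid₂−ν₃)), h]` (= `d₆ⱼ` line 3 minus `d6cT`),
  and `d6xT` verbatim on `[mid₂, max(mid₂, ν₃)]`).

Pure calculus; no new `Prop` facts, no statement about Theorems 1–2.
-/

noncomputable section

open Complex Real ComplexConjugate MeasureTheory Set intervalIntegral
open scoped Interval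

namespace Literature.NumberTheory.LFunctions.Zhang2022

namespace Repair

variable {θ : Theta} {ν k : ℝ}

/-- continuity of the `𝔣𝔣`-profiles (local copy for `fun_prop`). [cite: Zhang2022LandauSiegel, (8.13)–(8.18)] -/
@[fun_prop] private theorem ffT_cont' (k : ℝ) (j : ℕ) : Continuous (ffT k j) := by unfold ffT ffR; fun_prop

/-! ### `(ϰ, J₂)` with the component covering `J₂` -/

/-- **formula I on `(ϰ_{ν,k}, J̄₂)`, full coverage** (`1 − ν₂ ≤ ν ≤ 1`), `e = ν − (1−ν₂)`:
`∫₀¹(ϰ′+iπjϰ)·conj(tail f₂) = −(π²N_jh/ν)∫₀^{1−ν₁}𝔣𝔣(ν−(1−ν₁)+z)dz + (σ/ν)(−∫₀^h𝔣𝔣(e+h+z) + ∫₀^h𝔣𝔣(e+h+z)𝔶𝔶₁ʳ(mid₂−z))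
 + (σ/ν)(∫₀^h𝔣𝔣(e+z) + ∫₀^h𝔣𝔣(e+z)𝔶𝔶₂ʳ(hi₂−z))`. [cite: Zhang2022LandauSiegel, §10 after (10.15) p.57] -/
theorem integral_dip_kappa_rtent_full (h21 : θ.nu2 < θ.nu1) (h1 : θ.nu1 ≤ 1) (hν : 0 < ν)
    (hνhi : 1 - θ.nu2 ≤ ν) (hν1 : ν ≤ 1) (j : ℕ) :
    ∫ y in (0:ℝ)..1, dipoleIntegrand j (kappaP ν k) (kappaP' ν k) (tentT θ.reflectJ) (tentT' θ.reflectJ) y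
      = -(((π ^ 2 * bN j * θ.hw : ℝ)) : ℂ) * (((1 / ν : ℝ)) : ℂ) *
            (∫ z in (0:ℝ)..(1 - θ.nu1), ffT k j (ν - (1 - θ.nu1) + z))
        + (((1 / ν : ℝ)) : ℂ) * (θ.sig : ℂ) *
            (-(∫ z in (0:ℝ)..θ.hw, ffT k j (ν - (1 - θ.nu2) + θ.hw + z))
              + ∫ z in (0:ℝ)..θ.hw, ffT k j (ν - (1 - θ.nu2) + θ.hw + z) * yy1rT θ j (θ.mid2 - z))
        + (((1 / ν : ℝ)) : ℂ) * (θ.sig : ℂ) *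
            ((∫ z in (0:ℝ)..θ.hw, ffT k j (ν - (1 - θ.nu2) + z))
              + ∫ z in (0:ℝ)..θ.hw, ffT k j (ν - (1 - θ.nu2) + z) * yy2rT θ j (θ.hi2 - z)) := by
  have hr := reflectJ_lt h21
  obtain ⟨hml, hmh⟩ := θ.mid2_eq
  have hp := θ.hw_pos h21
  have hlo : 0 ≤ 1 - θ.nu1 := by linarith
  have hr1 : θ.reflectJ.nu1 ≤ 1 := by simp; linarith
  have hhi : θ.hi2 = 1 - θ.nu2 := rfl
  have hkf := kinkedProfile_tentT hr
  have hkk := kinkedProfile_kappaP (k := k) hν hν1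
  have hI := intervalIntegrable_dipoleIntegrand hkk hkf j
  have hsub : ∀ {a b : ℝ}, 0 ≤ a → a ≤ b → b ≤ 1 → IntervalIntegrable
      (dipoleIntegrand j (kappaP ν k) (kappaP' ν k) (tentT θ.reflectJ) (tentT' θ.reflectJ)) volume a b :=
    fun ha hab hb => hI.mono_set (by rw [uIcc_of_le zero_le_one, uIcc_of_le hab]; exact Icc_subset_Icc ha hb)
  -- below `J₂`: `y = lo₂ − z`
  set F0 : ℝ → ℂ := fun z => ffT k j (ν - (1 - θ.nu1) + z) with hF0
  have e0 : ∫ y in (0:ℝ)..(1 - θ.nu1),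
      dipoleIntegrand j (kappaP ν k) (kappaP' ν k) (tentT θ.reflectJ) (tentT' θ.reflectJ) y
      = -(((π ^ 2 * bN j * θ.hw : ℝ)) : ℂ) * (((1 / ν : ℝ)) : ℂ) * ∫ z in (0:ℝ)..(1 - θ.nu1), F0 z := by
    have hc : ∫ y in (0:ℝ)..(1 - θ.nu1), F0 ((1 - θ.nu1) - y) = ∫ z in (0:ℝ)..(1 - θ.nu1), F0 z := by
      have := intervalIntegral.integral_comp_sub_left F0 (1 - θ.nu1) (a := 0) (b := 1 - θ.nu1)
      simpa only [sub_self, sub_zero] using this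
    rw [← hc, ← intervalIntegral.integral_const_mul]
    refine intervalIntegral.integral_congr_uIoo fun y hy => ?_
    rw [uIoo_of_le hlo] at hy
    unfold dipoleIntegrand
    rw [kappaP'_add_eq_ffT hν.ne' j (by linarith [hy.2]), tentTail_below (θ := θ.reflectJ) hr hr1 (by simpa using hy.2) j,
      hF0]
    simp only [reflectJ_hw]
    rw [show ν - (1 - θ.nu1) + ((1 - θ.nu1) - y) = ν - y by ring]
    ring
  -- lower half of `J₂`: `y = mid₂ − z`
  set F1 : ℝ → ℂ := fun z => -ffT k j (ν - (1 - θ.nu2) + θ.hw + z)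
      + ffT k j (ν - (1 - θ.nu2) + θ.hw + z) * yy1rT θ j (θ.mid2 - z) with hF1
  have e1 : ∫ y in (1 - θ.nu1)..θ.mid2,
      dipoleIntegrand j (kappaP ν k) (kappaP' ν k) (tentT θ.reflectJ) (tentT' θ.reflectJ) y
      = (((1 / ν : ℝ)) : ℂ) * (θ.sig : ℂ) * ∫ z in (0:ℝ)..θ.hw, F1 z := by
    have hc : ∫ y in (1 - θ.nu1)..θ.mid2, F1 (θ.mid2 - y) = ∫ z in (0:ℝ)..θ.hw, F1 z := by
      have := intervalIntegral.integral_comp_sub_left F1 θ.mid2 (a := 1 - θ.nu1) (b := θ.mid2)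
      rw [sub_self, show θ.mid2 - (1 - θ.nu1) = θ.hw by rw [hml]; ring] at this
      exact this
    rw [← hc, ← intervalIntegral.integral_const_mul]
    refine intervalIntegral.integral_congr_uIoo fun y hy => ?_
    rw [uIoo_of_le (by linarith)] at hy
    unfold dipoleIntegrand
    rw [kappaP'_add_eq_ffT hν.ne' j (by linarith [hy.2]),
      tentTail_lower (θ := θ.reflectJ) hr hr1 (by simp; linarith [hy.1]) (by rw [reflectJ_mid1]; exact hy.2) j,
      yy1T_reflectJ, hF1]
    simp only [reflectJ_sig, sub_sub_cancel]
    rw [show ν - (1 - θ.nu2) + θ.hw + (θ.mid2 - y) = ν - y by rw [hmh]; ring]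
    ring
  -- upper half of `J₂`: `y = hi₂ − z`
  set F2 : ℝ → ℂ := fun z => ffT k j (ν - (1 - θ.nu2) + z)
      + ffT k j (ν - (1 - θ.nu2) + z) * yy2rT θ j (θ.hi2 - z) with hF2
  have e2 : ∫ y in θ.mid2..(1 - θ.nu2),
      dipoleIntegrand j (kappaP ν k) (kappaP' ν k) (tentT θ.reflectJ) (tentT' θ.reflectJ) y
      = (((1 / ν : ℝ)) : ℂ) * (θ.sig : ℂ) * ∫ z in (0:ℝ)..θ.hw, F2 z := by
    have hc : ∫ y in θ.mid2..(1 - θ.nu2), F2 ((1 - θ.nu2) - y) = ∫ z in (0:ℝ)..θ.hw, F2 z := by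
      have := intervalIntegral.integral_comp_sub_left F2 (1 - θ.nu2) (a := θ.mid2) (b := 1 - θ.nu2)
      rw [sub_self, show (1 - θ.nu2) - θ.mid2 = θ.hw by rw [hmh]; ring] at this
      exact this
    rw [← hc, ← intervalIntegral.integral_const_mul]
    refine intervalIntegral.integral_congr_uIoo fun y hy => ?_
    rw [uIoo_of_le (by linarith)] at hy
    unfold dipoleIntegrand
    rw [kappaP'_add_eq_ffT hν.ne' j (by linarith [hy.2]),
      tentTail_upper (θ := θ.reflectJ) hr hr1 (by rw [reflectJ_mid1]; exact hy.1.le) (by simpa using hy.2) j,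
      yy2T_reflectJ, hF2, hhi]
    simp only [reflectJ_sig, sub_sub_cancel]
    rw [show ν - (1 - θ.nu2) + ((1 - θ.nu2) - y) = ν - y by ring]
    ring
  -- above `J₂`
  have e3 : ∫ y in (1 - θ.nu2)..1,
      dipoleIntegrand j (kappaP ν k) (kappaP' ν k) (tentT θ.reflectJ) (tentT' θ.reflectJ) y = 0 := by
    rw [intervalIntegral.integral_congr_uIoo (g := fun _ => (0:ℂ)) fun y hy => ?_, intervalIntegral.integral_zero]
    rw [uIoo_of_le (by linarith)] at hy
    unfold dipoleIntegrand
    rw [tentTail_above (θ := θ.reflectJ) hr hr1 (by simpa using hy.1.le) j]; ring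
  have iA : IntervalIntegrable (fun z => -ffT k j (ν - (1 - θ.nu2) + θ.hw + z)) volume 0 θ.hw :=
    Continuous.intervalIntegrable (by fun_prop) _ _
  have iB : IntervalIntegrable (fun z => ffT k j (ν - (1 - θ.nu2) + θ.hw + z) * yy1rT θ j (θ.mid2 - z))
      volume 0 θ.hw := Continuous.intervalIntegrable (by unfold yy1rT; fun_prop) _ _
  have iC : IntervalIntegrable (fun z => ffT k j (ν - (1 - θ.nu2) + z)) volume 0 θ.hw :=
    Continuous.intervalIntegrable (by fun_prop) _ _
  have iD : IntervalIntegrable (fun z => ffT k j (ν - (1 - θ.nu2) + z) * yy2rT θ j (θ.hi2 - z)) volume 0 θ.hw :=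
    Continuous.intervalIntegrable (by unfold yy2rT; fun_prop) _ _
  have f1 : (∫ z in (0:ℝ)..θ.hw, F1 z) = -(∫ z in (0:ℝ)..θ.hw, ffT k j (ν - (1 - θ.nu2) + θ.hw + z))
      + ∫ z in (0:ℝ)..θ.hw, ffT k j (ν - (1 - θ.nu2) + θ.hw + z) * yy1rT θ j (θ.mid2 - z) := by
    rw [hF1, intervalIntegral.integral_add iA iB, intervalIntegral.integral_neg]
  have f2 : (∫ z in (0:ℝ)..θ.hw, F2 z) = (∫ z in (0:ℝ)..θ.hw, ffT k j (ν - (1 - θ.nu2) + z))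
      + ∫ z in (0:ℝ)..θ.hw, ffT k j (ν - (1 - θ.nu2) + z) * yy2rT θ j (θ.hi2 - z) := by
    rw [hF2, intervalIntegral.integral_add iC iD]
  have t1 := intervalIntegral.integral_add_adjacent_intervals
    (hsub (a := 0) (b := 1 - θ.nu1) le_rfl hlo (by linarith))
    (hsub (a := 1 - θ.nu1) (b := 1) hlo (by linarith) le_rfl)
  have t2 := intervalIntegral.integral_add_adjacent_intervals
    (hsub (a := 1 - θ.nu1) (b := θ.mid2) hlo (by linarith) (by linarith))
    (hsub (a := θ.mid2) (b := 1) (by linarith) (by linarith) le_rfl)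
  have t3 := intervalIntegral.integral_add_adjacent_intervals
    (hsub (a := θ.mid2) (b := 1 - θ.nu2) (by linarith) (by linarith) (by linarith))
    (hsub (a := 1 - θ.nu2) (b := 1) (by linarith) (by linarith) le_rfl)
  rw [← t1, ← t2, ← t3, e0, e1, e2, e3, f1, f2]
  simp only [hF0, add_zero]
  ring

/-! ### `(ϰ₃, J₂)` with the component ending inside `J₂` -/

/-- **formula I on `(ϰ_{ν₃,k₃}, J̄₂)`, partial coverage** (`1−ν₁ < ν₃ ≤ 1−ν₂`):
`∫₀¹(ϰ₃′+iπjϰ₃)·conj(tail f₂) = −(π²N_jh/ν₃)∫₀^{1−ν₁}𝔣𝔣₃(L₆+z)dz + (σ/ν₃)(−∫_{g₀}^{L₆}𝔣𝔣₃ + ∫_{min(h,max(0,mid₂−ν₃))}^{h}𝔣𝔣₃(ν₃−mid₂+z)𝔶𝔶₁ʳ(mid₂−z)dz)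
 + (σ/ν₃)∫_{mid₂}^{max(mid₂,ν₃)}𝔣𝔣₃(ν₃−y)(1+𝔶𝔶₂ʳ(y))dy` (`d₆ⱼ` line 1, `d′₆ⱼ`, `d₆ⱼ` line 3 minus `d6cT`, `d6xT`).
[cite: Zhang2022LandauSiegel, §10 (10.15)–(10.16) p.57] -/
theorem integral_dip_kappa_rtent_part (h2 : 0 ≤ θ.nu2) (h21 : θ.nu2 < θ.nu1) (h1 : θ.nu1 ≤ 1) (h3 : 0 < θ.nu3)
    (h3lo : 1 - θ.nu1 < θ.nu3) (h3hi : θ.nu3 ≤ 1 - θ.nu2) (j : ℕ) :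
    ∫ y in (0:ℝ)..1, dipoleIntegrand j (kappaP θ.nu3 θ.k3) (kappaP' θ.nu3 θ.k3) (tentT θ.reflectJ) (tentT' θ.reflectJ) y
      = -(((π ^ 2 * bN j * θ.hw : ℝ)) : ℂ) * (((1 / θ.nu3 : ℝ)) : ℂ) *
            (∫ z in (0:ℝ)..(1 - θ.nu1), ffT θ.k3 j (θ.L6 + z))
        + (((1 / θ.nu3 : ℝ)) : ℂ) * (θ.sig : ℂ) *
            (-(∫ w in θ.g0..θ.L6, ffT θ.k3 j w)
              + ∫ z in (min θ.hw (max 0 (θ.mid2 - θ.nu3)))..θ.hw,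
                  ffT θ.k3 j (θ.nu3 - θ.mid2 + z) * yy1rT θ j (θ.mid2 - z))
        + (((1 / θ.nu3 : ℝ)) : ℂ) * (θ.sig : ℂ) *
            ∫ y in θ.mid2..max θ.mid2 θ.nu3, ffT θ.k3 j (θ.nu3 - y) * (1 + yy2rT θ j y) := by
  have hr := reflectJ_lt h21
  obtain ⟨hml, hmh⟩ := θ.mid2_eq
  obtain ⟨cg0, cL6, -, cc0⟩ := θ.clip_eqs h21 h3lo.le h3hi
  have hp := θ.hw_pos h21
  have hlo : 0 ≤ 1 - θ.nu1 := by linarith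
  have hr1 : θ.reflectJ.nu1 ≤ 1 := by simp; linarith
  have h31 : θ.nu3 ≤ 1 := by linarith
  have hkf := kinkedProfile_tentT hr
  have hkk := kinkedProfile_kappaP (k := θ.k3) h3 h31
  have hI := intervalIntegrable_dipoleIntegrand hkk hkf j
  have hsub : ∀ {a b : ℝ}, 0 ≤ a → a ≤ b → b ≤ 1 → IntervalIntegrable
      (dipoleIntegrand j (kappaP θ.nu3 θ.k3) (kappaP' θ.nu3 θ.k3) (tentT θ.reflectJ) (tentT' θ.reflectJ))
        volume a b :=
    fun ha hab hb => hI.mono_set (by rw [uIcc_of_le zero_le_one, uIcc_of_le hab]; exact Icc_subset_Icc ha hb)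
  set m3 := min θ.nu3 θ.mid2 with hm3
  set x3 := max θ.mid2 θ.nu3 with hx3
  have hm3lo : 1 - θ.nu1 < m3 := lt_min h3lo (by linarith)
  have hm3mi : m3 ≤ θ.mid2 := min_le_right _ _
  have hx3mi : θ.mid2 ≤ x3 := le_max_left _ _
  have hx3hi : x3 ≤ 1 - θ.nu2 := max_le (by linarith) h3hi
  -- below `J₂`: `y = lo₂ − z`
  set F0 : ℝ → ℂ := fun z => ffT θ.k3 j (θ.L6 + z) with hF0
  have e0 : ∫ y in (0:ℝ)..(1 - θ.nu1),
      dipoleIntegrand j (kappaP θ.nu3 θ.k3) (kappaP' θ.nu3 θ.k3) (tentT θ.reflectJ) (tentT' θ.reflectJ) y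
      = -(((π ^ 2 * bN j * θ.hw : ℝ)) : ℂ) * (((1 / θ.nu3 : ℝ)) : ℂ) * ∫ z in (0:ℝ)..(1 - θ.nu1), F0 z := by
    have hc : ∫ y in (0:ℝ)..(1 - θ.nu1), F0 ((1 - θ.nu1) - y) = ∫ z in (0:ℝ)..(1 - θ.nu1), F0 z := by
      have := intervalIntegral.integral_comp_sub_left F0 (1 - θ.nu1) (a := 0) (b := 1 - θ.nu1)
      simpa only [sub_self, sub_zero] using this
    rw [← hc, ← intervalIntegral.integral_const_mul]
    refine intervalIntegral.integral_congr_uIoo fun y hy => ?_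
    rw [uIoo_of_le hlo] at hy
    unfold dipoleIntegrand
    rw [kappaP'_add_eq_ffT h3.ne' j (by linarith [hy.2]),
      tentTail_below (θ := θ.reflectJ) hr hr1 (by simpa using hy.2) j, hF0]
    simp only [reflectJ_hw]
    rw [show θ.L6 + ((1 - θ.nu1) - y) = θ.nu3 - y by rw [← cL6]; ring]
    ring
  -- lower half, covered part `[lo₂, m3]`: two pieces
  have e1 : ∫ y in (1 - θ.nu1)..m3,
      dipoleIntegrand j (kappaP θ.nu3 θ.k3) (kappaP' θ.nu3 θ.k3) (tentT θ.reflectJ) (tentT' θ.reflectJ) y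
      = (((1 / θ.nu3 : ℝ)) : ℂ) * (θ.sig : ℂ) *
          (-(∫ y in (1 - θ.nu1)..m3, ffT θ.k3 j (θ.nu3 - y))
            + ∫ y in (1 - θ.nu1)..m3, ffT θ.k3 j (θ.nu3 - y) * yy1rT θ j y) := by
    have iA : IntervalIntegrable (fun y => -ffT θ.k3 j (θ.nu3 - y)) volume (1 - θ.nu1) m3 :=
      Continuous.intervalIntegrable (by fun_prop) _ _
    have iB : IntervalIntegrable (fun y => ffT θ.k3 j (θ.nu3 - y) * yy1rT θ j y) volume (1 - θ.nu1) m3 :=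
      Continuous.intervalIntegrable (by unfold yy1rT; fun_prop) _ _
    rw [← intervalIntegral.integral_neg, ← intervalIntegral.integral_add iA iB,
      ← intervalIntegral.integral_const_mul]
    refine intervalIntegral.integral_congr_uIoo fun y hy => ?_
    rw [uIoo_of_le hm3lo.le] at hy
    have hy3 : y < θ.nu3 := lt_of_lt_of_le hy.2 (min_le_left _ _)
    unfold dipoleIntegrand
    rw [kappaP'_add_eq_ffT h3.ne' j hy3,
      tentTail_lower (θ := θ.reflectJ) hr hr1 (by simp; linarith [hy.1])
        (by rw [reflectJ_mid1]; exact lt_of_lt_of_le hy.2 hm3mi) j, yy1T_reflectJ]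
    simp only [reflectJ_sig]
    ring
  have s1a : ∫ y in (1 - θ.nu1)..m3, ffT θ.k3 j (θ.nu3 - y) = ∫ w in θ.g0..θ.L6, ffT θ.k3 j w := by
    have := intervalIntegral.integral_comp_sub_left (fun w => ffT θ.k3 j w) θ.nu3 (a := 1 - θ.nu1) (b := m3)
    rw [cg0, cL6] at this
    exact this
  have s1b : ∫ y in (1 - θ.nu1)..m3, ffT θ.k3 j (θ.nu3 - y) * yy1rT θ j y
      = ∫ z in (min θ.hw (max 0 (θ.mid2 - θ.nu3)))..θ.hw, ffT θ.k3 j (θ.nu3 - θ.mid2 + z) * yy1rT θ j (θ.mid2 - z) := by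
    have := intervalIntegral.integral_comp_sub_left
      (fun z => ffT θ.k3 j (θ.nu3 - θ.mid2 + z) * yy1rT θ j (θ.mid2 - z)) θ.mid2 (a := 1 - θ.nu1) (b := m3)
    rw [cc0, show θ.mid2 - (1 - θ.nu1) = θ.hw by rw [hml]; ring] at this
    rw [← this]
    refine intervalIntegral.integral_congr fun y _ => ?_
    simp only [sub_sub_cancel]
    rw [show θ.nu3 - θ.mid2 + (θ.mid2 - y) = θ.nu3 - y by ring]
  -- lower half, uncovered part `[m3, mid₂]`
  have e1' : ∫ y in m3..θ.mid2,
      dipoleIntegrand j (kappaP θ.nu3 θ.k3) (kappaP' θ.nu3 θ.k3) (tentT θ.reflectJ) (tentT' θ.reflectJ) y = 0 := by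
    rw [intervalIntegral.integral_congr_uIoo (g := fun _ => (0:ℂ)) fun y hy => ?_, intervalIntegral.integral_zero]
    rw [uIoo_of_le hm3mi] at hy
    have hy3 : θ.nu3 ≤ y := by
      rcases min_lt_iff.1 hy.1 with h | h
      · exact h.le
      · exact absurd h (not_lt.2 hy.2.le)
    unfold dipoleIntegrand
    rw [kappa_mside_of_ge h3.ne' j hy3]; ring
  -- upper half, covered part `[mid₂, x3]` (verbatim)
  have e2 : ∫ y in θ.mid2..x3,
      dipoleIntegrand j (kappaP θ.nu3 θ.k3) (kappaP' θ.nu3 θ.k3) (tentT θ.reflectJ) (tentT' θ.reflectJ) y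
      = (((1 / θ.nu3 : ℝ)) : ℂ) * (θ.sig : ℂ) *
          ∫ y in θ.mid2..x3, ffT θ.k3 j (θ.nu3 - y) * (1 + yy2rT θ j y) := by
    rw [← intervalIntegral.integral_const_mul]
    refine intervalIntegral.integral_congr_uIoo fun y hy => ?_
    rw [uIoo_of_le hx3mi] at hy
    have hy3 : y < θ.nu3 := by
      rcases lt_max_iff.1 hy.2 with h | h
      · exact absurd h (not_lt.2 hy.1.le)
      · exact h
    unfold dipoleIntegrand
    rw [kappaP'_add_eq_ffT h3.ne' j hy3,
      tentTail_upper (θ := θ.reflectJ) hr hr1 (by rw [reflectJ_mid1]; exact hy.1.le)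
        (by simp; linarith [hy.2]) j, yy2T_reflectJ]
    simp only [reflectJ_sig]
    ring
  -- upper half, uncovered part, and above `J₂`
  have e2' : ∫ y in x3..(1 - θ.nu2),
      dipoleIntegrand j (kappaP θ.nu3 θ.k3) (kappaP' θ.nu3 θ.k3) (tentT θ.reflectJ) (tentT' θ.reflectJ) y = 0 := by
    rw [intervalIntegral.integral_congr_uIoo (g := fun _ => (0:ℂ)) fun y hy => ?_, intervalIntegral.integral_zero]
    rw [uIoo_of_le hx3hi] at hy
    unfold dipoleIntegrand
    rw [kappa_mside_of_ge h3.ne' j ((le_max_right _ _).trans hy.1.le)]; ring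
  have e3 : ∫ y in (1 - θ.nu2)..1,
      dipoleIntegrand j (kappaP θ.nu3 θ.k3) (kappaP' θ.nu3 θ.k3) (tentT θ.reflectJ) (tentT' θ.reflectJ) y = 0 := by
    rw [intervalIntegral.integral_congr_uIoo (g := fun _ => (0:ℂ)) fun y hy => ?_, intervalIntegral.integral_zero]
    rw [uIoo_of_le (by linarith)] at hy
    unfold dipoleIntegrand
    rw [tentTail_above (θ := θ.reflectJ) hr hr1 (by simpa using hy.1.le) j]; ring
  have t1 := intervalIntegral.integral_add_adjacent_intervals
    (hsub (a := 0) (b := 1 - θ.nu1) le_rfl hlo (by linarith))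
    (hsub (a := 1 - θ.nu1) (b := 1) hlo (by linarith) le_rfl)
  have t2 := intervalIntegral.integral_add_adjacent_intervals
    (hsub (a := 1 - θ.nu1) (b := m3) hlo hm3lo.le (by linarith))
    (hsub (a := m3) (b := 1) (by linarith) (by linarith) le_rfl)
  have t3 := intervalIntegral.integral_add_adjacent_intervals
    (hsub (a := m3) (b := θ.mid2) (by linarith) hm3mi (by linarith))
    (hsub (a := θ.mid2) (b := 1) (by linarith) (by linarith) le_rfl)
  have t4 := intervalIntegral.integral_add_adjacent_intervals
    (hsub (a := θ.mid2) (b := x3) (by linarith) hx3mi (by linarith))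
    (hsub (a := x3) (b := 1) (by linarith) (by linarith) le_rfl)
  have t5 := intervalIntegral.integral_add_adjacent_intervals
    (hsub (a := x3) (b := 1 - θ.nu2) (by linarith) hx3hi (by linarith))
    (hsub (a := 1 - θ.nu2) (b := 1) (by linarith) (by linarith) le_rfl)
  rw [← t1, ← t2, ← t3, ← t4, ← t5, e0, e1, e1', e2, e2', e3, s1a, s1b]
  simp only [hF0, add_zero]
  ring

end Repair

end Literature.NumberTheory.LFunctions.Zhang2022
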